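import Summits.KontsevichZagierPeriods.KontsevichZagierPeriods.Theorems.HyperbolicBlochOffTetraSectorKernelLadderFamilyExists
import Summits.KontsevichZagierPeriods.KontsevichZagierPeriods.Theorems.HyperbolicBlochOffTetraSectorKernelPolytopeImageInversion
import Summits.KontsevichZagierPeriods.KontsevichZagierPeriods.Theorems.HyperbolicBlochOffTetraSectorKernelPolytopeImageSimilarity
import Summits.KontsevichZagierPeriods.KontsevichZagierPeriods.Theorems.HyperbolicBlochOffTetraSectorKernelStubSimilarityMove
import Summits.KontsevichZagierPeriods.KontsevichZagierPeriods.Theorems.HyperbolicBlochOffTetraSectorKernelStubInversionMove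
import Literature.NumberTheory.Transcendental.KZCalculusProofs

/-!
# Towards `stub_polytopeEnvelope`, cusp part — crux `OffTetraSectorKernel`, line `odd-hyperbolic-ladder` (v5, lead c3)

The cusp pieces `P ∩ ball(n, ρ)` of a finite-volume rung-2 polytope around its floor candidates `n` are sent to the
cusp at `∞` by the translation `q ↦ q − n` and the unit inversion (both LANDED moves of the calculus):
* `polyEnv_isGeodesicPolytope_inter_ball` — intersecting a polytope with a boundary-centred ball gives a polytope;
* `polyEnv_transport` — the representation is KZ-equivalent to a representation of the Möbius image (again a polytope);
* `polyEnv_image_normalForm` — the image of a normal-form set is the normal-form set of the EXPLICIT transformed rows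
  `(gᵢ(n), 2n₀Lᵢ₀ + Lᵢ₁, 2n₁Lᵢ₀ + Lᵢ₂, Lᵢ₀)` (`Ql (p + (n,0)) = Aₙ · Ql p`, `Ql (J q) = |q|⁻² · swap₀₃ (Ql q)`).

References: R. Benedetti, C. Petronio, *Lectures on Hyperbolic Geometry* (1992), A.3.5; M. Kontsevich, D. Zagier,
*Periods* (2001), §1.2.
-/

noncomputable section

open Set MeasureTheory
open Literature.NumberTheory.Transcendental

namespace Summit.KontsevichZagierPeriods.HyperbolicBloch.OffTetraSectorKernel

/-! ### Intersecting with a ball -/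

/-- A `ℚ̄`-geodesic polytope intersected with an open ball centred on the floor (algebraic centre and squared radius)
is a `ℚ̄`-geodesic polytope (one more hemisphere constraint; finite volume by restriction). [cite: Goncharov1999, §1.1] -/
theorem polyEnv_isGeodesicPolytope_inter_ball {P : Set (Fin 3 → ℝ)} (hP : KZ.IsGeodesicPolytope 2 P)
    (n : Fin 2 → ℝ) (hn : ∀ i, IsAlgebraic ℚ (n i)) (ρsq : ℝ) (hρ : IsAlgebraic ℚ ρsq) :
    KZ.IsGeodesicPolytope 2 (P ∩ {p | (p 0 - n 0) ^ 2 + (p 1 - n 1) ^ 2 + p 2 ^ 2 < ρsq}) := by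
  obtain ⟨k, flat, a, c, ε, ha, hc, hε, ha0, hPeq, hint⟩ := hP
  refine ⟨k + 1, Fin.cons false flat, Fin.cons ![n 0, n 1, 0] a, Fin.cons ρsq c, Fin.cons (-1) ε,
    ?_, ?_, ?_, ?_, ?_, ?_⟩
  · intro i
    refine Fin.cases ?_ (fun i => ?_) i
    · intro l
      simp only [Fin.cons_zero]
      fin_cases l
      · simpa using hn 0
      · simpa using hn 1
      · simpa using isAlgebraic_zero
    · simpa using ha i
  · intro i
    refine Fin.cases ?_ (fun i => ?_) i
    · simpa using hρ
    · simpa using hc i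
  · intro i
    refine Fin.cases ?_ (fun i => ?_) i
    · simp
    · simpa using hε i
  · intro i
    refine Fin.cases ?_ (fun i => ?_) i
    · rfl
    · simpa using ha0 i
  · rw [hPeq]
    ext p
    simp only [mem_inter_iff, mem_setOf_eq, Fin.forall_fin_succ, Fin.cons_zero, Fin.cons_succ]
    have e : ∑ l : Fin 3, (p l - (![n 0, n 1, 0] : Fin 3 → ℝ) l) ^ 2 = (p 0 - n 0) ^ 2 + (p 1 - n 1) ^ 2 + p 2 ^ 2 := by
      simp [Fin.sum_univ_three]
    simp only [Bool.false_eq_true, ↓reduceIte, e]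
    constructor
    · rintro ⟨⟨h0, hall⟩, hb⟩
      exact ⟨h0, by linarith, hall⟩
    · rintro ⟨h0, hb, hall⟩
      exact ⟨⟨h0, hall⟩, by linarith⟩
  · exact hint.mono_set inter_subset_left

/-! ### Transport of representations by the two landed moves -/

/-- The translation `(q, t) ↦ (q + b, t)` is the boundary similarity with `c = 1`, `A = 1`. [folklore] -/
theorem polyEnv_translate_apply (b : Fin 2 → ℝ) (p : Fin 3 → ℝ) :
    KZ.boundarySimilarity 2 1 1 b p = ![p 0 + b 0, p 1 + b 1, p 2] := by
  unfold KZ.boundarySimilarity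
  ext l
  fin_cases l
  · simp [Fin.snoc, Fin.init, Matrix.one_mulVec]
  · simp [Fin.snoc, Fin.init, Matrix.one_mulVec]
  · simp [Fin.snoc]

/-- Image of a set under the translation `(q, t) ↦ (q + b, t)`. [folklore] -/
theorem polyEnv_image_translate (b : Fin 2 → ℝ) (P : Set (Fin 3 → ℝ)) :
    KZ.boundarySimilarity 2 1 1 b '' P = {p | (![p 0 - b 0, p 1 - b 1, p 2] : Fin 3 → ℝ) ∈ P} := by
  ext p
  simp only [mem_image, mem_setOf_eq]
  constructor
  · rintro ⟨p', hp', rfl⟩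
    rw [polyEnv_translate_apply]
    convert hp'
    ext l
    fin_cases l <;> simp
  · intro hp
    refine ⟨_, hp, ?_⟩
    rw [polyEnv_translate_apply]
    ext l
    fin_cases l <;> simp

/-- **Transport.** A representation of `t⁻³` on a polytope `P'` is KZ-equivalent to a representation of `t⁻³` on the
image of `P'` under the translation by `b` followed by the unit inversion, which is again a polytope (landed
`stub_similarityMove`, `stub_inversionMove`, `isGeodesicPolytope_image_boundarySimilarity`,
`isGeodesicPolytope_image_unitInversion`). [cite: KontsevichZagier2001, §1.2 rule (2)] -/
theorem polyEnv_transport {P' : Set (Fin 3 → ℝ)} (hP' : KZ.IsGeodesicPolytope 2 P') (b : Fin 2 → ℝ)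
    (hb : ∀ i, IsAlgebraic ℚ (b i)) (r : KZ.IntegralRep 3) (hr : r.domain = P')
    (hri : EqOn r.integrand (fun p => 1 / p 2 ^ 3) P') :
    ∃ r'' : KZ.IntegralRep 3, KZ.IsGeodesicPolytope 2 r''.domain ∧
      r''.domain = KZ.unitInversion 2 '' (KZ.boundarySimilarity 2 1 1 b '' P') ∧
      EqOn r''.integrand (fun p => 1 / p 2 ^ 3) r''.domain ∧ KZ.Equivalent r r'' := by
  have hdens : ∀ p : Fin 3 → ℝ, KZ.hypDensity 2 p = 1 / p 2 ^ 3 := fun p => by simp [KZ.hypDensity, Fin.last]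
  have h1alg : ∀ i j : Fin 2, IsAlgebraic ℚ ((1 : Matrix (Fin 2) (Fin 2) ℝ) i j) := fun i j => by
    rw [Matrix.one_apply]; split_ifs; exacts [isAlgebraic_one, isAlgebraic_zero]
  have hP₁ : KZ.IsGeodesicPolytope 2 (KZ.boundarySimilarity 2 1 1 b '' P') :=
    isGeodesicPolytope_image_boundarySimilarity 2 1 1 b isAlgebraic_one one_pos h1alg (by simp) hb P' hP'
  have hQ : KZ.IsGeodesicPolytope 2 (KZ.unitInversion 2 '' (KZ.boundarySimilarity 2 1 1 b '' P')) :=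
    isGeodesicPolytope_image_unitInversion 2 _ hP₁
  set r₁ := geodesicPolytopeRep hP₁ with hr₁
  set r₂ := geodesicPolytopeRep hQ with hr₂
  have e1 : KZ.Equivalent r r₁ := by
    refine stub_similarityMove 2 1 1 b isAlgebraic_one one_pos h1alg (by simp) hb r r₁ ?_ ?_ ?_ ?_
    · rw [hr]; exact subset_upperHalfSpace_of_isGeodesicPolytope hP'
    · intro p hp
      rw [hri (hr ▸ hp)]
      rfl
    · rw [hr]; rfl
    · intro p _
      show KZ.hypDensity 2 p = _
      rw [hdens]
      rfl
  have e2 : KZ.Equivalent r₁ r₂ := by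
    refine stub_inversionMove 2 r₁ r₂ ?_ ?_ ?_ ?_
    · exact subset_upperHalfSpace_of_isGeodesicPolytope hP₁
    · intro p _
      show KZ.hypDensity 2 p = _
      rw [hdens]
      rfl
    · rfl
    · intro p _
      show KZ.hypDensity 2 p = _
      rw [hdens]
      rfl
  exact ⟨r₂, hQ, rfl, fun p _ => hdens p, e1.trans e2⟩

/-! ### The image of a normal form is an explicit normal form -/

/-- The unit inversion of `ℝ³` in coordinates. [folklore] -/
theorem polyEnv_unitInversion_apply (q : Fin 3 → ℝ) (l : Fin 3) :
    KZ.unitInversion 2 q l = q l / (q 0 ^ 2 + q 1 ^ 2 + q 2 ^ 2) := by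
  simp [KZ.unitInversion, Fin.sum_univ_three]

/-- **Key identity**: a lifted linear constraint evaluated at `J q + (n, 0)` is `|q|⁻²` times the TRANSFORMED constraint
`(gᵢ(n), 2n₀m₀ + m₁, 2n₁m₀ + m₂, m₀)` evaluated at `Ql q`. [cite: BenedettiPetronio1992, A.3.5] -/
theorem polyEnv_constraint_transform (Ql : (Fin 3 → ℝ) → Fin 4 → ℝ)
    (hQl : ∀ p, Ql p = ![p 0 ^ 2 + p 1 ^ 2 + p 2 ^ 2, p 0, p 1, 1]) (m : Fin 4 → ℝ) (n : Fin 2 → ℝ)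
    (q : Fin 3 → ℝ) (hs : q 0 ^ 2 + q 1 ^ 2 + q 2 ^ 2 ≠ 0) :
    ∑ c, m c * Ql (![q 0 / (q 0 ^ 2 + q 1 ^ 2 + q 2 ^ 2) + n 0, q 1 / (q 0 ^ 2 + q 1 ^ 2 + q 2 ^ 2) + n 1,
      q 2 / (q 0 ^ 2 + q 1 ^ 2 + q 2 ^ 2)]) c =
      (∑ c, (![m 0 * (n 0 ^ 2 + n 1 ^ 2) + m 1 * n 0 + m 2 * n 1 + m 3, 2 * n 0 * m 0 + m 1,
        2 * n 1 * m 0 + m 2, m 0] : Fin 4 → ℝ) c * Ql q c) / (q 0 ^ 2 + q 1 ^ 2 + q 2 ^ 2) := by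
  simp only [hQl, Fin.sum_univ_four]
  simp only [Matrix.cons_val_zero, Matrix.cons_val_one, Matrix.cons_val_two, Matrix.cons_val_three,
    Matrix.head_cons, Matrix.tail_cons]
  field_simp
  ring

/-- **Normal form of the Möbius image.** Translating a normal-form set by `−n` and inverting in the unit sphere gives
the normal-form set of the transformed rows. [cite: BenedettiPetronio1992, A.3.5] -/
theorem polyEnv_image_normalForm : ∀ (Ql : (Fin 3 → ℝ) → Fin 4 → ℝ),
    (∀ p, Ql p = ![p 0 ^ 2 + p 1 ^ 2 + p 2 ^ 2, p 0, p 1, 1]) → ∀ (k : ℕ) (L : Fin k → Fin 4 → ℝ)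
    (n : Fin 2 → ℝ) (P' : Set (Fin 3 → ℝ)), P' = {p | 0 < p 2 ∧ ∀ i, 0 < ∑ c, L i c * Ql p c} →
    KZ.unitInversion 2 '' (KZ.boundarySimilarity 2 1 1 ![-n 0, -n 1] '' P') =
      {q | 0 < q 2 ∧ ∀ i, 0 < ∑ c, (![L i 0 * (n 0 ^ 2 + n 1 ^ 2) + L i 1 * n 0 + L i 2 * n 1 + L i 3,
        2 * n 0 * L i 0 + L i 1, 2 * n 1 * L i 0 + L i 2, L i 0] : Fin 4 → ℝ) c * Ql q c} := by
  intro Ql hQl k L n P' hP'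
  have hup : KZ.boundarySimilarity 2 1 1 ![-n 0, -n 1] '' P' ⊆ {p | 0 < p (Fin.last 2)} := by
    rw [polyEnv_image_translate, hP']
    intro p hp
    simpa using hp.1
  rw [image_unitInversion_eq hup, polyEnv_image_translate]
  ext q
  simp only [mem_setOf_eq, hP', Matrix.cons_val_zero, Matrix.cons_val_one, Matrix.cons_val_two,
    Matrix.head_cons, Matrix.tail_cons, sub_neg_eq_add]
  constructor
  · rintro ⟨hq2, -, hall⟩
    have hs : 0 < q 0 ^ 2 + q 1 ^ 2 + q 2 ^ 2 := by positivity
    refine ⟨hq2, fun i => ?_⟩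
    have h := hall i
    simp only [polyEnv_unitInversion_apply] at h
    rw [polyEnv_constraint_transform Ql hQl (L i) n q hs.ne'] at h
    exact (div_pos_iff_of_pos_right hs).mp h
  · rintro ⟨hq2, hall⟩
    have hs : 0 < q 0 ^ 2 + q 1 ^ 2 + q 2 ^ 2 := by positivity
    refine ⟨hq2, ?_, fun i => ?_⟩
    · simp only [polyEnv_unitInversion_apply]
      exact div_pos hq2 hs
    · simp only [polyEnv_unitInversion_apply]
      rw [polyEnv_constraint_transform Ql hQl (L i) n q hs.ne']
      exact div_pos (hall i) hs

/-- Membership in the Möbius image: `q` lies in `J (τ₋ₙ P')` iff `0 < q₂` and the point `J q + (n, 0)` lies in `P'`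
(for `P'` in the open upper half-space). [folklore] -/
theorem polyEnv_mem_image_iff (n : Fin 2 → ℝ) {P' : Set (Fin 3 → ℝ)} (hP' : P' ⊆ {p | 0 < p 2}) (q : Fin 3 → ℝ) :
    q ∈ KZ.unitInversion 2 '' (KZ.boundarySimilarity 2 1 1 ![-n 0, -n 1] '' P') ↔
      0 < q 2 ∧ (![q 0 / (q 0 ^ 2 + q 1 ^ 2 + q 2 ^ 2) + n 0, q 1 / (q 0 ^ 2 + q 1 ^ 2 + q 2 ^ 2) + n 1,
        q 2 / (q 0 ^ 2 + q 1 ^ 2 + q 2 ^ 2)] : Fin 3 → ℝ) ∈ P' := by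
  have hup : KZ.boundarySimilarity 2 1 1 ![-n 0, -n 1] '' P' ⊆ {p | 0 < p (Fin.last 2)} := by
    rw [polyEnv_image_translate]
    intro p hp
    simpa using hP' hp
  rw [image_unitInversion_eq hup, polyEnv_image_translate]
  simp only [mem_setOf_eq, Matrix.cons_val_zero, Matrix.cons_val_one, sub_neg_eq_add, polyEnv_unitInversion_apply]
  rfl

/-- The map `q ↦ J q + (n, 0)` inverts `p ↦ J (p − (n, 0))` on the upper half-space. [folklore] -/
theorem polyEnv_back_apply (n : Fin 2 → ℝ) (p : Fin 3 → ℝ) (hp : 0 < p 2) :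
    let q := KZ.unitInversion 2 ![p 0 - n 0, p 1 - n 1, p 2]
    (![q 0 / (q 0 ^ 2 + q 1 ^ 2 + q 2 ^ 2) + n 0, q 1 / (q 0 ^ 2 + q 1 ^ 2 + q 2 ^ 2) + n 1,
      q 2 / (q 0 ^ 2 + q 1 ^ 2 + q 2 ^ 2)] : Fin 3 → ℝ) = p ∧ 0 < q 2 := by
  intro q
  have hs : (![p 0 - n 0, p 1 - n 1, p 2] : Fin 3 → ℝ) 0 ^ 2 + (![p 0 - n 0, p 1 - n 1, p 2] : Fin 3 → ℝ) 1 ^ 2 +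
      (![p 0 - n 0, p 1 - n 1, p 2] : Fin 3 → ℝ) 2 ^ 2 ≠ 0 := by
    simp only [Matrix.cons_val_zero, Matrix.cons_val_one, Matrix.cons_val_two, Matrix.head_cons, Matrix.tail_cons]
    positivity
  have hsum : ∑ m, (![p 0 - n 0, p 1 - n 1, p 2] : Fin 3 → ℝ) m ^ 2 ≠ 0 := by
    simpa [Fin.sum_univ_three] using hs
  have hJJ : KZ.unitInversion 2 q = ![p 0 - n 0, p 1 - n 1, p 2] := unitInversion_unitInversion hsum
  have hcomp : ∀ l, q l / (q 0 ^ 2 + q 1 ^ 2 + q 2 ^ 2) = (![p 0 - n 0, p 1 - n 1, p 2] : Fin 3 → ℝ) l := by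
    intro l
    rw [← polyEnv_unitInversion_apply q l, hJJ]
  constructor
  · ext l
    fin_cases l
    · simp [hcomp 0]
    · simp [hcomp 1]
    · simp [hcomp 2]
  · show 0 < KZ.unitInversion 2 ![p 0 - n 0, p 1 - n 1, p 2] 2
    rw [polyEnv_unitInversion_apply]
    simp only [Matrix.cons_val_two, Matrix.tail_cons, Matrix.head_cons, Matrix.cons_val_zero, Matrix.cons_val_one]
    positivity

end Summit.KontsevichZagierPeriods.HyperbolicBloch.OffTetraSectorKernel

end
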